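/-
Copyright (c) 2026 the pub-hodgecm-mathlib formalisation cell (harness21).  Prover seat hodgecm-mathlib-F0P3a-p08 (g25): LH4-plan (g6) WORD #64 (a)
«M1 LITERAL LAYER 2∕5» (the ½-free twin of ★ `UnitFundamentalLemmaInertFlickerClasses` + ★ `UnitFundamentalLemmaInertFlickerKappaSigns` over the trace frame
`Q_b` of ★ p851724 `FlickerTorusTraceFrame`); 2026-09-02.
-/
import Literature.NumberTheory.Rogawski1990.FlickerTorusTraceFrame                        -- ★ p851724 (P3′): `Q_b`, `t₁^{(b)}`, Gram `diag(1,1,−1)`, `diag(π,1,1)·Q_b`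
import Literature.NumberTheory.Rogawski1990.UnitFundamentalLemmaInertFlickerKappaSigns      -- ★ the originals (FILE 3 + κ-signs) and their 2-free API (reused by name)
import HarnessLib

/-!
# Flicker's Prop. 3 in the TRACE FRAME: the four classes `{⟦t₁⟧, ⟦t_π⟧, ⟦t₃⟧, ⟦t₄⟧}` of the type-(1) torus and their signs `κ_v = (+1, +1, −1, −1)`,
# with NO `e = ½`, NO `x x̄ = 2`, NO `y ȳ = −2`, NO `|2| = 1` — every residue characteristic
# (Flicker 1998 §2 Prop. 3, §5; Rogawski 1990 §3.5 Prop. 3.5.2, §3.6, §4.3 (4.3.2); Jacobowitz 1962 §7)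

Topic `NumberTheory/Rogawski1990`; namespace `Literature.NumberTheory.Rogawski1990`.  THEOREMS ONLY (no definition, no instance, no notation, no named fact,
no `sorry`); count-neutral; kernel lane `--supports stmt-HodgeConjecture-24833`.  Cell `pub/hodgecm-mathlib` (D-0151), crux H413 = `stmt-HodgeConjecture-24833`,
half A line LH4 (dyadic pay-down; (D-UNR) PRINT by ruling D74′), LEAD T13-42 price list (4), LH4-plan (g6) WORD #64 (a) = CENSUS-M1 bf2b9cff8e6aee20 (LH4-p01 (g6)) §3 row 3
under-layer «literal layer 2∕5»: the (C)-class uses of ★ `…FlickerClasses` :117∕:129 and ★ `…FlickerKappaSigns` :69–:76 (the sign vectors of Flicker's conjugators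
`g₃, g₄`, which need `2 = x x̄`, `−2 = y ȳ`) RE-BASED on the trace frame `Q_b = (1 0 1; 0 1 0; b 0 −σb)`, `b + σb = 1` (★ p851724: Gram `diag(1, 1, −1)` — UNIT
lengths).  HONEST READER LABEL: BANKED base layer, consumers none live (the M1 re-base of the 14 consumers is undealt, T13-35); HC_CM is proved only modulo the 7
printed citations (2 remaining named inputs: hLiu418 = stmt-HodgeConjecture-24832, h413 = stmt-HodgeConjecture-24833) until rung 0 closes; pays no organ, opens no road.

DESIGN (census line F0∕P3a 14:41:44Z).  The three non-trivial conjugators enter through the `Φ₃`-GRAM OF THEIR FRAMES, not through closed-form literals: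
`diag(π,1,1)·Q_b` has Gram `diag(π, 1, −π)` (★ (T5) `twistGram_diag_mul_traceFrame`), and the two Jacobowitz frames of the (P3″) file (LH4-p01 (g6)) have Grams
`diag(π, −π, −1)` (pattern `(1,1,0)`, needs a unit `ε` of norm `−1`) and `diag(1, π, −π)` (pattern `(0,1,1)`, `ε`-free); here those two Grams are HYPOTHESES
(`hG₃`, `hG₄`) on an arbitrary conjugator `g` with frame `g·Q_b`, so this file docks on ANY realisation of the two length patterns and imports nothing unlanded.
The norm tests then read «`π ∉ N(E_v^×)`» and «`1, −1 ∈ N`» ONLY (`−1 = σε·ε`; at an inert-unramified place every unit is a norm, every residue characteristic —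
★ `UnramifiedQuadraticNormSurjective`), never `±2 ∈ N`.

CONTENTS.
* §1 (any field `K`, involution `σ`) the SIGN VECTORS relative to `Q_b`: `normTest_traceFrame_pi_iff` `(1,0,1)` (twin of ★ `normTest_flickerFrame_pi_iff`, no `h2`),
  `normTest_frame110_iff` `(1,1,0)` (twin of ★ `normTest_frameThree_iff`, `hx : x x̄ = 2` ↦ `hε : σε·ε = −1`), `normTest_frame011_iff` `(0,1,1)` (twin of ★
  `normTest_frameFour_iff`, `hy : y ȳ = −2` ↦ nothing); conjugator forms `normTest_diag_conj_traceFrame_iff`, `normTest_conj110_iff`, `normTest_conj011_iff`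
  (twins of ★ `…FlickerClasses` :106 :117 :129).  ★ `normTest_flickerFrame_one_iff` ∕ ★ `normTest_one_conj_iff` are frame-generic and are REUSED, not twinned.
* §2 (any commutative ring) `conj_mem_unitaryGroup_of_frame`: an eigenframe conjugate `g t g⁻¹` whose frame `g·Q` is `H`-ORTHOGONAL (diagonal Gram) is unitary when the
  eigenvalues have norm one — how the consumer forms `⟨g t₁^{(b)} g⁻¹, _⟩` with no closed inverse of the frame (replaces ★ `conj_mem_unitaryGroup_of_mul_eq` + the
  closed-form products ★ `gThree_mul_flickerTorusElt_one` ∕ `gFour_…`); `exists_gl_mul_eq_frame` (the conjugator `g := P′·Q⁻¹` of two invertible frames).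
* §3 `conjClassesIn_traceTorusElt_eq` — FLICKER'S PROP. 3 at a non-split place in the trace frame: the `U(Φ₃)(F_v)`-classes in the stable class of
  `τ₁ = t₁^{(b)}(a, m, d)` are `{⟦τ₁⟧, ⟦dπ τ₁ dπ⁻¹⟧, ⟦g₃ τ₁ g₃⁻¹⟧, ⟦g₄ τ₁ g₄⁻¹⟧}`, four distinct classes (twin of ★ `conjClassesIn_flickerTorusElt_eq`, binders
  `h2 hx hy hP₁ hg₃ hg₄` ↦ `hb hε hQ hG₃ hG₄`).
* §4 `finKappaAt_trace_representatives_eq` — the signs `κ_v(γ_H, t₁…t₄) = (+1, +1, −1, −1)` of four matched representatives in the CM-local currency of ★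
  `finKappaAt_flicker_representatives_eq` (binders `h2 hx hy hPP₁ hP₁ hg₃ hg₄` ↦ `hb hε hPQ hQ hG₃ hG₄`): `κ(t₁) = +1` because the MIDDLE length of `Q_b` is `1`.

## References
* [Flicker1998UnitaryFL] Y. Z. Flicker, *Elementary proof of the fundamental lemma for a unitary group*, Canad. J. Math. 50 (1998), §2 Prop. 3 pp. 78–79, §5 p. 95.
* [Rogawski1990] J. D. Rogawski, *Automorphic Representations of Unitary Groups in Three Variables* (1990), §3.1 p. 19, §3.5 Prop. 3.5.2 (a)(c) p. 29, §3.6 p. 31,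
  §4.3 (4.3.2) p. 43, §4.9 Prop. 4.9.1 p. 55.
* [Jacobowitz1962] R. Jacobowitz, *Hermitian forms over local fields*, Amer. J. Math. 84 (1962), §7 Thm. 7.1 (unramified dyadic: the trace condition; units are norms).
-/

set_option autoImplicit false

noncomputable section

open Matrix NumberField IsDedekindDomain
open scoped MatrixGroups

namespace Literature.NumberTheory.Rogawski1990

open Literature.NumberTheory.Automorphic Literature.NumberTheory.Automorphic.UnitaryGroup
open Literature.AlgebraicGeometry.ShimuraVarieties (unitaryGroup)

/-! ## §1 The sign vectors relative to the trace frame `Q_b` (any field, any residue characteristic) -/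

section FieldTests

variable {K : Type*} [Field K] (σ : K →+* K)

/-- `σ(ε z)·(ε z) = (σε·ε)·(σz·z)`; with `σε·ε = −1`: `= −(σz·z)` — norms are stable under the sign. [folklore] -/
private theorem norm_eps_mul {ε : K} (hε : σ ε * ε = -1) (z : K) : σ (ε * z) * (ε * z) = -(σ z * z) := by
  rw [map_mul]
  linear_combination (σ z * z) * hε

/-- **Sign vector of `t_π^{(b)}` relative to `t₁^{(b)}`: `(1, 0, 1)`** — the frame `diag(π,1,1)·Q_b` has `Φ₃`-lengths `(π, 1, −π)` (★ `twistGram_diag_mul_traceFrame`)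
against `(1, 1, −1)` (★ `twistGram_traceFrame`): slot ratios `π, 1, π`, and `π` is not a norm.  Twin of ★ `normTest_flickerFrame_pi_iff` WITHOUT `h2 : 2 ≠ 0`
(there the lengths were `(−2π, 1, 2π)` against `(−2, 1, 2)`). [cite: Flicker1998UnitaryFL, §2 Prop. 3 p. 79] [cite: Rogawski1990, §3.5 Prop. 3.5.2 (a) p. 29; §3.6 p. 31] -/
theorem normTest_traceFrame_pi_iff (hσσ : ∀ x, σ (σ x) = x) {b : K} (hb : b + σ b = 1) {π : K} (hσπ : σ π = π) (hπN : ∀ z : K, σ z * z ≠ π)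
    (i : Fin 3) :
    (∃ z : K, IsUnit z ∧
        twistGram σ (Matrix.of fun i j : Fin 3 => if i.val + j.val + 1 = 3 then (1 : K) else 0)
            (!![π, 0, 0; 0, 1, 0; 0, 0, 1] * !![(1 : K), 0, 1; 0, 1, 0; b, 0, -σ b]) i i =
          σ z * z * twistGram σ (Matrix.of fun i j : Fin 3 => if i.val + j.val + 1 = 3 then (1 : K) else 0) !![(1 : K), 0, 1; 0, 1, 0; b, 0, -σ b] i i) ↔
      (![1, 0, 1] : Fin 3 → ZMod 2) i = 0 := by
  rw [twistGram_diag_mul_traceFrame σ hσσ hb hσπ, twistGram_traceFrame σ hσσ hb]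
  fin_cases i
  · refine ⟨fun ⟨z, _, hz⟩ => absurd ?_ (hπN z), fun h => absurd h (by decide)⟩
    have hz' : π = σ z * z * 1 := hz
    rw [hz', mul_one]
  · exact ⟨fun _ => rfl, fun _ => ⟨1, isUnit_one, by simp⟩⟩
  · refine ⟨fun ⟨z, _, hz⟩ => absurd ?_ (hπN z), fun h => absurd h (by decide)⟩
    have hz' : -π = σ z * z * -1 := hz
    linear_combination hz'

/-- **Sign vector `(1, 1, 0)`** — a frame `F` with `Φ₃`-lengths `(π, −π, −1)` (the `(1,1,0)` Jacobowitz frame on `u₃ = (1,0,−σb)`, hyperbolic pair through a unit `ε`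
of norm `−1`) against `Q_b`'s `(1, 1, −1)`: slot ratios `π`, `−π`, `1`; `−π` is not a norm because `−1 = σε·ε` is.  Twin of ★ `normTest_frameThree_iff` with
`hx : σx·x = 2` REPLACED by `hε : σε·ε = −1` (no `h2`). [cite: Flicker1998UnitaryFL, §2 Prop. 3 p. 79] [cite: Rogawski1990, §3.5 Prop. 3.5.2 (a) p. 29; §3.6 p. 31]
[cite: Jacobowitz1962, §7 Thm. 7.1] -/
theorem normTest_frame110_iff (hσσ : ∀ x, σ (σ x) = x) {b : K} (hb : b + σ b = 1) {π ε : K} (hπN : ∀ z : K, σ z * z ≠ π) (hε : σ ε * ε = -1)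
    {F : Matrix (Fin 3) (Fin 3) K}
    (hF : twistGram σ (Matrix.of fun i j : Fin 3 => if i.val + j.val + 1 = 3 then (1 : K) else 0) F = !![π, 0, 0; 0, -π, 0; 0, 0, -1]) (i : Fin 3) :
    (∃ z : K, IsUnit z ∧
        twistGram σ (Matrix.of fun i j : Fin 3 => if i.val + j.val + 1 = 3 then (1 : K) else 0) F i i =
          σ z * z * twistGram σ (Matrix.of fun i j : Fin 3 => if i.val + j.val + 1 = 3 then (1 : K) else 0) !![(1 : K), 0, 1; 0, 1, 0; b, 0, -σ b] i i) ↔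
      (![1, 1, 0] : Fin 3 → ZMod 2) i = 0 := by
  rw [hF, twistGram_traceFrame σ hσσ hb]
  fin_cases i
  · refine ⟨fun ⟨z, _, hz⟩ => absurd ?_ (hπN z), fun h => absurd h (by decide)⟩
    have hz' : π = σ z * z * 1 := hz
    rw [hz', mul_one]
  · refine ⟨fun ⟨z, _, hz⟩ => absurd ?_ (hπN (ε * z)), fun h => absurd h (by decide)⟩
    have hz' : -π = σ z * z * 1 := hz
    rw [norm_eps_mul σ hε]
    linear_combination hz'
  · refine ⟨fun _ => rfl, fun _ => ⟨1, isUnit_one, ?_⟩⟩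
    have h : (-1 : K) = σ 1 * 1 * -1 := by rw [map_one, one_mul, one_mul]
    exact h

/-- **Sign vector `(0, 1, 1)`** — a frame `F` with `Φ₃`-lengths `(1, π, −π)` (the `(0,1,1)` Jacobowitz frame on `u₁ = (1,0,b)`, `ε`-free) against `Q_b`'s `(1, 1, −1)`: slot
ratios `1`, `π`, `π`.  Twin of ★ `normTest_frameFour_iff` with `hy : σy·y = −2` DELETED (no `h2`). [cite: Flicker1998UnitaryFL, §2 Prop. 3 p. 79]
[cite: Rogawski1990, §3.5 Prop. 3.5.2 (a) p. 29; §3.6 p. 31] -/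
theorem normTest_frame011_iff (hσσ : ∀ x, σ (σ x) = x) {b : K} (hb : b + σ b = 1) {π : K} (hπN : ∀ z : K, σ z * z ≠ π)
    {F : Matrix (Fin 3) (Fin 3) K}
    (hF : twistGram σ (Matrix.of fun i j : Fin 3 => if i.val + j.val + 1 = 3 then (1 : K) else 0) F = !![1, 0, 0; 0, π, 0; 0, 0, -π]) (i : Fin 3) :
    (∃ z : K, IsUnit z ∧
        twistGram σ (Matrix.of fun i j : Fin 3 => if i.val + j.val + 1 = 3 then (1 : K) else 0) F i i =
          σ z * z * twistGram σ (Matrix.of fun i j : Fin 3 => if i.val + j.val + 1 = 3 then (1 : K) else 0) !![(1 : K), 0, 1; 0, 1, 0; b, 0, -σ b] i i) ↔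
      (![0, 1, 1] : Fin 3 → ZMod 2) i = 0 := by
  rw [hF, twistGram_traceFrame σ hσσ hb]
  fin_cases i
  · exact ⟨fun _ => rfl, fun _ => ⟨1, isUnit_one, by simp⟩⟩
  · refine ⟨fun ⟨z, _, hz⟩ => absurd ?_ (hπN z), fun h => absurd h (by decide)⟩
    have hz' : π = σ z * z * 1 := hz
    rw [hz', mul_one]
  · refine ⟨fun ⟨z, _, hz⟩ => absurd ?_ (hπN z), fun h => absurd h (by decide)⟩
    have hz' : -π = σ z * z * -1 := hz
    linear_combination hz'

/-- The tests of the conjugator `diag(π,1,1)` against `Q_b` read `(1,0,1)` (twin of ★ `normTest_diag_conj_iff`, frame `P₁ ↦ Q_b`, no `h2`).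
[cite: Flicker1998UnitaryFL, §2 Prop. 3 p. 79] [cite: Rogawski1990, §3.5 Prop. 3.5.2 (a) p. 29] -/
theorem normTest_diag_conj_traceFrame_iff (hσσ : ∀ x, σ (σ x) = x) {b : K} (hb : b + σ b = 1) {π : K} (hσπ : σ π = π) (hπN : ∀ z : K, σ z * z ≠ π)
    {Q dπ : GL (Fin 3) K} (hQ : Q.val = !![(1 : K), 0, 1; 0, 1, 0; b, 0, -σ b]) (hdπ : dπ.val = !![π, 0, 0; 0, 1, 0; 0, 0, 1]) (i : Fin 3) :
    (∃ z : K, IsUnit z ∧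
        twistGram σ (Matrix.of fun i j : Fin 3 => if i.val + j.val + 1 = 3 then (1 : K) else 0) (dπ.val * Q.val) i i =
          σ z * z * twistGram σ (Matrix.of fun i j : Fin 3 => if i.val + j.val + 1 = 3 then (1 : K) else 0) Q.val i i) ↔
      (![1, 0, 1] : Fin 3 → ZMod 2) i = 0 := by
  rw [hdπ, hQ]
  exact normTest_traceFrame_pi_iff σ hσσ hb hσπ hπN i

/-- The tests of a conjugator `g` whose frame `g·Q_b` has `Φ₃`-Gram `diag(π, −π, −1)` read `(1,1,0)` (twin of ★ `normTest_gThree_conj_iff`: Flicker's `g₃` with its `e`'s and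
`hx : x x̄ = 2` ↦ ANY conjugator onto the `(1,1,0)` length pattern, `hε : σε·ε = −1`). [cite: Flicker1998UnitaryFL, §2 Prop. 3 p. 79]
[cite: Rogawski1990, §3.5 Prop. 3.5.2 (a) p. 29] [cite: Jacobowitz1962, §7 Thm. 7.1] -/
theorem normTest_conj110_iff (hσσ : ∀ x, σ (σ x) = x) {b : K} (hb : b + σ b = 1) {π ε : K} (hπN : ∀ z : K, σ z * z ≠ π) (hε : σ ε * ε = -1)
    {Q g : GL (Fin 3) K} (hQ : Q.val = !![(1 : K), 0, 1; 0, 1, 0; b, 0, -σ b])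
    (hG : twistGram σ (Matrix.of fun i j : Fin 3 => if i.val + j.val + 1 = 3 then (1 : K) else 0) (g.val * Q.val) = !![π, 0, 0; 0, -π, 0; 0, 0, -1])
    (i : Fin 3) :
    (∃ z : K, IsUnit z ∧
        twistGram σ (Matrix.of fun i j : Fin 3 => if i.val + j.val + 1 = 3 then (1 : K) else 0) (g.val * Q.val) i i =
          σ z * z * twistGram σ (Matrix.of fun i j : Fin 3 => if i.val + j.val + 1 = 3 then (1 : K) else 0) Q.val i i) ↔
      (![1, 1, 0] : Fin 3 → ZMod 2) i = 0 := by
  have h := normTest_frame110_iff σ hσσ hb hπN hε hG i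
  rwa [← hQ] at h

/-- The tests of a conjugator `g` whose frame `g·Q_b` has `Φ₃`-Gram `diag(1, π, −π)` read `(0,1,1)` (twin of ★ `normTest_gFour_conj_iff`: Flicker's `g₄` and `hy : y ȳ = −2`
↦ ANY conjugator onto the `(0,1,1)` length pattern, no extra seed). [cite: Flicker1998UnitaryFL, §2 Prop. 3 p. 79] [cite: Rogawski1990, §3.5 Prop. 3.5.2 (a) p. 29] -/
theorem normTest_conj011_iff (hσσ : ∀ x, σ (σ x) = x) {b : K} (hb : b + σ b = 1) {π : K} (hπN : ∀ z : K, σ z * z ≠ π)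
    {Q g : GL (Fin 3) K} (hQ : Q.val = !![(1 : K), 0, 1; 0, 1, 0; b, 0, -σ b])
    (hG : twistGram σ (Matrix.of fun i j : Fin 3 => if i.val + j.val + 1 = 3 then (1 : K) else 0) (g.val * Q.val) = !![1, 0, 0; 0, π, 0; 0, 0, -π])
    (i : Fin 3) :
    (∃ z : K, IsUnit z ∧
        twistGram σ (Matrix.of fun i j : Fin 3 => if i.val + j.val + 1 = 3 then (1 : K) else 0) (g.val * Q.val) i i =
          σ z * z * twistGram σ (Matrix.of fun i j : Fin 3 => if i.val + j.val + 1 = 3 then (1 : K) else 0) Q.val i i) ↔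
      (![0, 1, 1] : Fin 3 → ZMod 2) i = 0 := by
  have h := normTest_frame011_iff σ hσσ hb hπN hG i
  rwa [← hQ] at h

end FieldTests

/-! ## §2 Orthogonal-frame conjugates are unitary (any commutative ring): how `⟨g t₁^{(b)} g⁻¹, _⟩ : U(σ, H)` is formed without a closed inverse of the frame -/

section Membership

variable {R : Type*} [CommRing R] (σ : R →+* R) {n : Type*} [Fintype n] [DecidableEq n]

/-- The conjugator between two invertible frames: `g := P′·Q⁻¹` has `g·Q = P′` (how the consumer realises the two Jacobowitz frames as conjugates of `Q_b`).
[cite: Rogawski1990, §3.1 p. 19] -/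
theorem exists_gl_mul_eq_frame (Q P' : GL n R) : ∃ g : GL n R, g.val * Q.val = P'.val :=
  ⟨P' * Q⁻¹, by rw [Units.val_mul, Matrix.mul_assoc, ← Units.val_mul, inv_mul_cancel, Units.val_one, Matrix.mul_one]⟩

/-- `(g t g⁻¹)·(g Q) = (g Q)·D` from `t·Q = Q·D`: the conjugate has the eigenframe `g·Q` with the same eigenvalues. [cite: Rogawski1990, §3.1 p. 19] -/
theorem conj_val_mul_frame {t g Q : GL n R} {D : Matrix n n R} (hP : t.val * Q.val = Q.val * D) :
    (g * t * g⁻¹).val * (g.val * Q.val) = g.val * Q.val * D := by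
  rw [Units.val_mul, Units.val_mul, Matrix.mul_assoc, Matrix.mul_assoc, ← Matrix.mul_assoc (g⁻¹).val, ← Units.val_mul, inv_mul_cancel,
    Units.val_one, Matrix.one_mul, hP, Matrix.mul_assoc]

/-- **ORTHOGONAL EIGENFRAME WITH NORM-ONE EIGENVALUES ⇒ UNITARY.**  If `t·Q = Q·diag(u)` with `σ(uᵢ)uᵢ = 1` and the frame `g·Q` is `H`-orthogonal — `ᵗσ(gQ)·H·(gQ) = diag(ℓ)`
— then `g t g⁻¹ ∈ U(σ, H)`: in the frame `P′ = gQ` both `ᵗσ(g t g⁻¹)·H·(g t g⁻¹)` and `H` have Gram `diag(σuᵢ·ℓᵢ·uᵢ) = diag(ℓ)`, and `P′` is invertible.  This is how the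
classes `⟦g t₁^{(b)} g⁻¹⟧` of §3 are formed from the two Jacobowitz frames (Grams `diag(π,−π,−1)`, `diag(1,π,−π)`) with no closed-form inverse of either frame (contrast
★ `conj_mem_unitaryGroup_of_mul_eq`, which wants the conjugated literal). [cite: Rogawski1990, §3.1 p. 19; §3.5 Prop. 3.5.2 (a) p. 29] [cite: Flicker1998UnitaryFL, §2 Prop. 3 p. 79] -/
theorem conj_mem_unitaryGroup_of_frame (H : Matrix n n R) {t g Q : GL n R} {u : n → R} (hP : t.val * Q.val = Q.val * diagonal u)
    (hu1 : ∀ i, σ (u i) * u i = 1) {ℓ : n → R} (hG : twistGram σ H (g.val * Q.val) = diagonal ℓ) :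
    g * t * g⁻¹ ∈ unitaryGroup σ H := by
  rw [Literature.AlgebraicGeometry.ShimuraVarieties.mem_unitaryGroup_iff]
  change twistGram σ H (g * t * g⁻¹).val = H
  set M : Matrix n n R := (g * t * g⁻¹).val with hM
  set P' : Matrix n n R := g.val * Q.val with hP'
  -- both Grams agree after transport to the frame `P′`
  have hD : ((diagonal u).map σ)ᵀ * diagonal ℓ * diagonal u = diagonal ℓ := by
    rw [diagonal_map (map_zero σ), diagonal_transpose, diagonal_mul_diagonal, diagonal_mul_diagonal]
    congr 1
    funext i
    rw [mul_assoc, mul_comm (ℓ i), ← mul_assoc, hu1, one_mul]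
  have hframe : (P'.map σ)ᵀ * twistGram σ H M * P' = (P'.map σ)ᵀ * H * P' := by
    rw [← twistGram_mul, hM, hP', conj_val_mul_frame hP, ← hP', twistGram_mul, hG, hD, ← hG, twistGram_def]
  -- cancel the invertible frame on both sides
  have hP'u : IsUnit P' := by rw [hP', ← Units.val_mul]; exact Units.isUnit _
  have hA : IsUnit ((P'.map σ)ᵀ) := by
    rw [Matrix.isUnit_iff_isUnit_det, Matrix.det_transpose, ← RingHom.mapMatrix_apply, ← RingHom.map_det]
    exact ((Matrix.isUnit_iff_isUnit_det _).1 hP'u).map σ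
  have h1 : (P'.map σ)ᵀ * (twistGram σ H M * P') = (P'.map σ)ᵀ * (H * P') := by
    simpa only [Matrix.mul_assoc] using hframe
  exact hP'u.mul_right_cancel (hA.mul_left_cancel h1)

end Membership

/-! ## §3 Flicker's Prop. 3 in the trace frame: the four classes at a non-split place -/

section LocalClasses

variable {F : Type} (E : Type) [Field F] [NumberField F] [Field E] [NumberField E] [Algebra F E]
  [Algebra.IsQuadraticExtension F E] (v : HeightOneSpectrum (𝓞 F)) (c : E ≃ₐ[F] E) {δ : E} (hcδ : c δ = -δ) (hδ : δ ≠ 0)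

/-- A four-element set with pairwise distinct members has `ncard = 4` (★ FILE 3's private helper, re-proved). [folklore] -/
private theorem ncard_four'' {α : Type*} {p q r s : α} (hpq : p ≠ q) (hpr : p ≠ r) (hps : p ≠ s) (hqr : q ≠ r) (hqs : q ≠ s) (hrs : r ≠ s) :
    ({p, q, r, s} : Set α).ncard = 4 := by
  rw [Set.ncard_insert_of_notMem (by simp [hpq, hpr, hps]), Set.ncard_insert_of_notMem (by simp [hqr, hqs]), Set.ncard_pair hrs]

/-- Distinct sign vectors separate: if the tests of `g₁`, `g₂` read `ε₁`, `ε₂` and agree slot by slot, then `ε₁ = ε₂` (★ FILE 3's private helper, re-proved). [folklore] -/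
private theorem signs_eq_of_tests_iff' {ι : Type*} {T₁ T₂ : ι → Prop} {ε₁ ε₂ : ι → ZMod 2} (h₁ : ∀ i, (T₁ i ↔ ε₁ i = 0))
    (h₂ : ∀ i, (T₂ i ↔ ε₂ i = 0)) (hsep : ∀ i, (T₂ i ↔ T₁ i)) : ε₁ = ε₂ := by
  funext i
  have h01 : ∀ t : ZMod 2, t = 0 ∨ t = 1 := by decide
  have key : (ε₂ i = 0 ↔ ε₁ i = 0) := ((h₂ i).symm.trans (hsep i)).trans (h₁ i)
  rcases h01 (ε₁ i) with ha | ha <;> rcases h01 (ε₂ i) with hb | hb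
  · rw [ha, hb]
  · exact absurd (key.2 ha) (by rw [hb]; decide)
  · exact absurd (key.1 hb) (by rw [ha]; decide)
  · rw [ha, hb]

/-- `![a, m, d]` is injective for pairwise distinct `a, m, d` (★ FILE 3's private helper, re-proved). [folklore] -/
private theorem injective_vecThree' {α : Type*} {a m d : α} (ham : a ≠ m) (hmd : m ≠ d) (had : a ≠ d) : Function.Injective ![a, m, d] := by
  intro i j hij
  fin_cases i <;> fin_cases j
  all_goals first | rfl | (exfalso; revert hij; simp [ham, hmd, had, ham.symm, hmd.symm, had.symm])

include hcδ hδ in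
/-- **FLICKER'S PROP. 3 (type (1), `Φ₃`-native) IN THE TRACE FRAME — THE LOCAL STABLE CLASS OF `t₁^{(b)}` IS `{⟦t₁⟧, ⟦t_π⟧, ⟦t₃⟧, ⟦t₄⟧}`, FOUR DISTINCT CLASSES,
at EVERY residue characteristic.**  At a non-split place `v` of `F` (`K = E_v`, `σ = c ⊗ 1`): `b` with `b + σb = 1` (the trace seed, (K1)), `ε` with `σε·ε = −1`
(a unit of norm `−1`), `π` a `σ`-fixed NON-norm, pairwise distinct norm-one `a, m, d`; `Q = Q_b = (1 0 1; 0 1 0; b 0 −σb)`, `dπ = diag(π,1,1)`, and conjugators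
`g₃, g₄ ∈ GL₃(E_v)` whose frames `g₃·Q_b`, `g₄·Q_b` have `Φ₃`-Grams `diag(π, −π, −1)` and `diag(1, π, −π)` (the two Jacobowitz frames of the (P3″) file, or any other
realisation); `τ₁, τ_π, τ₃, τ₄ ∈ U(Φ₃)(F_v)` with `τ₁ = t₁^{(b)}(a, m, d) = (aσb + db, 0, a − d; 0, m, 0; bσb(a − d), 0, ab + dσb)` (★ (T3)), `τ_π = dπ τ₁ dπ⁻¹`,
`τ₃ = g₃ τ₁ g₃⁻¹`, `τ₄ = g₄ τ₁ g₄⁻¹` (memberships: §2 `conj_mem_unitaryGroup_of_frame`).  Then `conjClassesIn σ Φ₃ τ₁ = {⟦τ₁⟧, ⟦τ_π⟧, ⟦τ₃⟧, ⟦τ₄⟧}`, pairwise distinct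
(sign vectors `(0,0,0), (1,0,1), (1,1,0), (0,1,1)` of §1, separated by ★ `forall_normTest_iff_of_mk_eq_mk`; exhaustion by ★ `ncard_conjClassesIn_eq_four` — both
frame-generic and `2`-free).  Twin of ★ `conjClassesIn_flickerTorusElt_eq` with `h2 : 2e = 1`, `hx : x x̄ = 2`, `hy : y ȳ = −2` ELIMINATED.
[cite: Flicker1998UnitaryFL, §2 Prop. 3 pp. 78–79] [cite: Rogawski1990, §3.5 Prop. 3.5.2 (a)(c) p. 29; §3.6 p. 31] [cite: Jacobowitz1962, §7 Thm. 7.1] -/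
theorem conjClassesIn_traceTorusElt_eq (w : PlacesOver E v) (hw : c • w.1 = w.1)
    {b ε π a m d : LocalRing E v} (hb : b + conjLocal E c v b = 1) (hε : conjLocal E c v ε * ε = -1) (hσπ : conjLocal E c v π = π)
    (hπN : ∀ z : LocalRing E v, conjLocal E c v z * z ≠ π)
    (ha : conjLocal E c v a * a = 1) (hm : conjLocal E c v m * m = 1) (hd : conjLocal E c v d * d = 1)
    (ham : a ≠ m) (hmd : m ≠ d) (had : a ≠ d)
    {Q dπ g₃ g₄ : GL (Fin 3) (LocalRing E v)}
    (hQ : Q.val = !![(1 : LocalRing E v), 0, 1; 0, 1, 0; b, 0, -conjLocal E c v b]) (hdπ : dπ.val = !![π, 0, 0; 0, 1, 0; 0, 0, 1])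
    (hG₃ : twistGram (conjLocal E c v) (Matrix.of fun i j : Fin 3 => if i.val + j.val + 1 = 3 then (1 : LocalRing E v) else 0) (g₃.val * Q.val) =
      !![π, 0, 0; 0, -π, 0; 0, 0, -1])
    (hG₄ : twistGram (conjLocal E c v) (Matrix.of fun i j : Fin 3 => if i.val + j.val + 1 = 3 then (1 : LocalRing E v) else 0) (g₄.val * Q.val) =
      !![1, 0, 0; 0, π, 0; 0, 0, -π])
    {τ₁ τπ τ₃ τ₄ : ↥(unitaryGroup (conjLocal E c v) (Matrix.of fun i j : Fin 3 => if i.val + j.val + 1 = 3 then (1 : LocalRing E v) else 0))}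
    (hτ₁ : τ₁.val.val = !![a * conjLocal E c v b + d * b, 0, a - d; 0, m, 0; b * conjLocal E c v b * (a - d), 0, a * b + d * conjLocal E c v b])
    (hτπ : τπ.val = dπ * τ₁.val * dπ⁻¹) (hτ₃ : τ₃.val = g₃ * τ₁.val * g₃⁻¹) (hτ₄ : τ₄.val = g₄ * τ₁.val * g₄⁻¹) :
    conjClassesIn (conjLocal E c v) (Matrix.of fun i j : Fin 3 => if i.val + j.val + 1 = 3 then (1 : LocalRing E v) else 0) τ₁ =
        {ConjClasses.mk τ₁, ConjClasses.mk τπ, ConjClasses.mk τ₃, ConjClasses.mk τ₄} ∧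
      ConjClasses.mk τ₁ ≠ ConjClasses.mk τπ ∧ ConjClasses.mk τ₁ ≠ ConjClasses.mk τ₃ ∧ ConjClasses.mk τ₁ ≠ ConjClasses.mk τ₄ ∧
      ConjClasses.mk τπ ≠ ConjClasses.mk τ₃ ∧ ConjClasses.mk τπ ≠ ConjClasses.mk τ₄ ∧ ConjClasses.mk τ₃ ≠ ConjClasses.mk τ₄ := by
  classical
  letI : Field (LocalRing E v) :=
    (Liu2021.LemD1IndexedNonVacuityNonsplitPlace.isField_localRing_of_nonsplit E v c hcδ hδ w hw).toField
  have hσσ : ∀ s, conjLocal E c v (conjLocal E c v s) = s := Liu2021.LemD1OfPlace.conjLocal_conjLocal_apply E v c hcδ hδ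
  -- hermitian data of `Φ₃`
  have hH := antidiagOne_map_transpose (R := LocalRing E v) (conjLocal E c v)
  have hHd := isUnit_det_antidiagOne_three (R := LocalRing E v)
  -- destructure the four elements, then abstract the unitary group once
  obtain ⟨t₁, hU₁⟩ := τ₁
  obtain ⟨tπ, hUπ⟩ := τπ
  obtain ⟨t₃, hU₃⟩ := τ₃
  obtain ⟨t₄, hU₄⟩ := τ₄
  simp only at hτ₁ hτπ hτ₃ hτ₄
  subst hτπ hτ₃ hτ₄
  revert hU₁ hUπ hU₃ hU₄
  set U := unitaryGroup (conjLocal E c v) (Matrix.of fun i j : Fin 3 => if i.val + j.val + 1 = 3 then (1 : LocalRing E v) else 0) with hU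
  intro hU₁ hUπ hU₃ hU₄
  -- the eigenframe of `t₁` is the trace frame
  have hP : t₁.val * Q.val = Q.val * diagonal ![a, m, d] := by
    rw [hτ₁, hQ, traceTorusElt_mul_frame (conjLocal E c v) hb, etaDiag_eq_diagonal]
  have hu : Function.Injective ![a, m, d] := injective_vecThree' ham hmd had
  have hu1 : ∀ i, conjLocal E c v (![a, m, d] i) * ![a, m, d] i = 1 := by
    intro i
    fin_cases i
    · exact ha
    · exact hm
    · exact hd
  -- `t₁` as the trivial conjugate
  have h1U : (1 : GL (Fin 3) (LocalRing E v)) * t₁ * 1⁻¹ ∈ U := by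
    rw [one_mul, inv_one, mul_one]; exact hU₁
  have e₁ : (⟨t₁, hU₁⟩ : ↥U) = ⟨1 * t₁ * 1⁻¹, h1U⟩ := Subtype.ext (show t₁ = 1 * t₁ * 1⁻¹ by rw [one_mul, inv_one, mul_one])
  -- the norm tests of a stable conjugator, relative to the frame `Q_b`
  set T : GL (Fin 3) (LocalRing E v) → Fin 3 → Prop := fun g i =>
    ∃ z : LocalRing E v, IsUnit z ∧
      twistGram (conjLocal E c v) (Matrix.of fun i j : Fin 3 => if i.val + j.val + 1 = 3 then (1 : LocalRing E v) else 0) (g.val * Q.val) i i =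
        conjLocal E c v z * z *
          twistGram (conjLocal E c v) (Matrix.of fun i j : Fin 3 => if i.val + j.val + 1 = 3 then (1 : LocalRing E v) else 0) Q.val i i with hT
  -- sign vectors (§1)
  have hT1 : ∀ i, (T 1 i ↔ (![0, 0, 0] : Fin 3 → ZMod 2) i = 0) := fun i => normTest_one_conj_iff (conjLocal E c v) Q i
  have hTπ : ∀ i, (T dπ i ↔ (![1, 0, 1] : Fin 3 → ZMod 2) i = 0) := fun i =>
    normTest_diag_conj_traceFrame_iff (conjLocal E c v) hσσ hb hσπ hπN hQ hdπ i
  have hT3 : ∀ i, (T g₃ i ↔ (![1, 1, 0] : Fin 3 → ZMod 2) i = 0) := fun i =>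
    normTest_conj110_iff (conjLocal E c v) hσσ hb hπN hε hQ hG₃ i
  have hT4 : ∀ i, (T g₄ i ↔ (![0, 1, 1] : Fin 3 → ZMod 2) i = 0) := fun i =>
    normTest_conj011_iff (conjLocal E c v) hσσ hb hπN hQ hG₄ i
  -- equal classes have equal tests (★ `forall_normTest_iff_of_mk_eq_mk`), hence equal sign vectors
  have ne_of_signs : ∀ {g₁ g₂ : GL (Fin 3) (LocalRing E v)} (h₁ : g₁ * t₁ * g₁⁻¹ ∈ U) (h₂ : g₂ * t₁ * g₂⁻¹ ∈ U)
      {ε₁ ε₂ : Fin 3 → ZMod 2} (hε₁ : ∀ i, (T g₁ i ↔ ε₁ i = 0)) (hε₂ : ∀ i, (T g₂ i ↔ ε₂ i = 0)) (hne : ε₁ ≠ ε₂),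
      ConjClasses.mk (⟨g₁ * t₁ * g₁⁻¹, h₁⟩ : ↥U) ≠ ConjClasses.mk ⟨g₂ * t₁ * g₂⁻¹, h₂⟩ := by
    intro g₁ g₂ h₁ h₂ ε₁ ε₂ hε₁ hε₂ hne hmk
    exact hne (signs_eq_of_tests_iff' hε₁ hε₂ (fun i => forall_normTest_iff_of_mk_eq_mk E v c hcδ hδ w hw hH hHd hU₁ hP hu hu1 hmk i))
  have n1π : ConjClasses.mk (⟨t₁, hU₁⟩ : ↥U) ≠ ConjClasses.mk ⟨dπ * t₁ * dπ⁻¹, hUπ⟩ := by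
    rw [e₁]; exact ne_of_signs h1U hUπ hT1 hTπ (by decide)
  have n13 : ConjClasses.mk (⟨t₁, hU₁⟩ : ↥U) ≠ ConjClasses.mk ⟨g₃ * t₁ * g₃⁻¹, hU₃⟩ := by
    rw [e₁]; exact ne_of_signs h1U hU₃ hT1 hT3 (by decide)
  have n14 : ConjClasses.mk (⟨t₁, hU₁⟩ : ↥U) ≠ ConjClasses.mk ⟨g₄ * t₁ * g₄⁻¹, hU₄⟩ := by
    rw [e₁]; exact ne_of_signs h1U hU₄ hT1 hT4 (by decide)
  have nπ3 : ConjClasses.mk (⟨dπ * t₁ * dπ⁻¹, hUπ⟩ : ↥U) ≠ ConjClasses.mk ⟨g₃ * t₁ * g₃⁻¹, hU₃⟩ :=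
    ne_of_signs hUπ hU₃ hTπ hT3 (by decide)
  have nπ4 : ConjClasses.mk (⟨dπ * t₁ * dπ⁻¹, hUπ⟩ : ↥U) ≠ ConjClasses.mk ⟨g₄ * t₁ * g₄⁻¹, hU₄⟩ :=
    ne_of_signs hUπ hU₄ hTπ hT4 (by decide)
  have n34 : ConjClasses.mk (⟨g₃ * t₁ * g₃⁻¹, hU₃⟩ : ↥U) ≠ ConjClasses.mk ⟨g₄ * t₁ * g₄⁻¹, hU₄⟩ :=
    ne_of_signs hU₃ hU₄ hT3 hT4 (by decide)
  -- the four classes lie in the stable class and exhaust it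
  have hS4 := ncard_conjClassesIn_eq_four E v c hcδ hδ w hw hH hHd hU₁ hP hu hu1
  have hSfin := finite_conjClassesIn_of_eigenframe E v c hcδ hδ w hw hH hHd hU₁ hP hu hu1
  have hmem : ∀ (g' : GL (Fin 3) (LocalRing E v)) (hg' : g' * t₁ * g'⁻¹ ∈ U),
      ConjClasses.mk (⟨g' * t₁ * g'⁻¹, hg'⟩ : ↥U) ∈
        conjClassesIn (conjLocal E c v) (Matrix.of fun i j : Fin 3 => if i.val + j.val + 1 = 3 then (1 : LocalRing E v) else 0) ⟨t₁, hU₁⟩ :=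
    fun g' hg' => mk_mem_conjClassesIn_iff.2 (isStablyConj_iff.2 ⟨g', rfl⟩)
  have hsub : ({ConjClasses.mk (⟨t₁, hU₁⟩ : ↥U), ConjClasses.mk ⟨dπ * t₁ * dπ⁻¹, hUπ⟩, ConjClasses.mk ⟨g₃ * t₁ * g₃⁻¹, hU₃⟩,
      ConjClasses.mk ⟨g₄ * t₁ * g₄⁻¹, hU₄⟩} : Set (ConjClasses ↥U)) ⊆
        conjClassesIn (conjLocal E c v) (Matrix.of fun i j : Fin 3 => if i.val + j.val + 1 = 3 then (1 : LocalRing E v) else 0) ⟨t₁, hU₁⟩ := by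
    intro z hz
    simp only [Set.mem_insert_iff, Set.mem_singleton_iff] at hz
    rcases hz with rfl | rfl | rfl | rfl
    · exact mk_mem_conjClassesIn_self _
    · exact hmem dπ hUπ
    · exact hmem g₃ hU₃
    · exact hmem g₄ hU₄
  have h4 := ncard_four'' n1π n13 n14 nπ3 nπ4 n34
  have heq := Set.eq_of_subset_of_ncard_le hsub (by rw [hS4, h4]) hSfin
  exact ⟨heq.symm, n1π, n13, n14, nπ3, nπ4, n34⟩

end LocalClasses

/-! ## §4 The signs `κ_v(γ_H, tᵢ) = (+1, +1, −1, −1)` of the four representatives (values-abstract, CM-local currency) -/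

section Signs

variable (L : Type) [Field L] [NumberField L] [IsCMField L] (v : HeightOneSpectrum (𝓞 ↥(maximalRealSubfield L)))
  (H' : Matrix (Fin 3) (Fin 3) L)
  (a : (UnitaryGroup.cmDatum L 2 (Matrix.of fun i j : Fin 2 => if i.val + j.val + 1 = 2 then (1 : L) else 0)).Local v ×
      (UnitaryGroup.cmDatum L 1 (Matrix.of fun i j : Fin 1 => if i.val + j.val + 1 = 1 then (1 : L) else 0)).Local v)
  (w : UnitaryGroup.PlacesOver L v) (hw : IsCMField.complexConj L • w.1 = w.1)

/-- A CM field has a non-zero element negated by complex conjugation (`ζ − ζ̄` for any `ζ` moved by `c ≠ 1`; ★ `LocalStableClassesNonsplitKappaCount`'s private helper,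
re-proved). [cite: Rogawski1990, §1.9 p. 8] -/
private theorem exists_complexConj_eq_neg_ne_zero' : ∃ δ : L, IsCMField.complexConj L δ = -δ ∧ δ ≠ 0 := by
  obtain ⟨ζ, hζ⟩ := not_forall.1 fun h0 => IsCMField.complexConj_ne_one L (AlgEquiv.ext h0)
  refine ⟨ζ - IsCMField.complexConj L ζ, by rw [map_sub, IsCMField.complexConj_apply_apply, neg_sub], fun h0 => hζ ?_⟩
  rw [sub_eq_zero] at h0
  exact h0.symm

include hw in
open scoped Classical in
/-- **THE SIGNS `κ_v(γ_H, t₁…t₄) = (+1, +1, −1, −1)` IN THE TRACE FRAME** — four matched representatives in the position of the (re-based) package: `t₁` with the type-(1)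
frame `P = Tl⁻¹ Q_b` (eigenvalues `(a₁, u, d₁)`, `u` = the `U(1)`-slot in the MIDDLE; `ᵗσ(Tl) Φ₃ Tl = H′_v`), and `Tl tᵢ Tl⁻¹ = gᵢ (Tl t₁ Tl⁻¹) gᵢ⁻¹` for conjugators
`g₂ = diag(π,1,1)` and `g₃, g₄` whose frames `gᵢ·Q_b` have `Φ₃`-Grams `diag(π,−π,−1)`, `diag(1,π,−π)` (`π` a `σ`-fixed non-norm, `b + σb = 1`, `σε·ε = −1`).  `κ(t₁) = +1`
since the middle length of `Q_b` is `1` (★ (T1)); then Rogawski's (4.3.2) in the frame (★ `finKappaAt_conj_eq_iff_normTest`) reads the MIDDLE slots `0, 1, 1` of §1's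
sign vectors.  Twin of ★ `finKappaAt_flicker_representatives_eq` with `h2 hx hy` ELIMINATED. [cite: Flicker1998UnitaryFL, §2 Prop. 3 pp. 78–79; §5 p. 95]
[cite: Rogawski1990, §4.3 (4.3.2) p. 43; §3.5 Prop. 3.5.2 (c) p. 29; §4.9 Prop. 4.9.1 p. 55] [cite: Jacobowitz1962, §7 Thm. 7.1] -/
theorem finKappaAt_trace_representatives_eq
    (hu : IsUnit ((finCharpolyTwo L v a).eval (finGammaTwo L v a)))
    (hH : (((UnitaryGroup.adelicForm L 3 H').map (UnitaryGroup.adeleToLocal L v)).map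
      (UnitaryGroup.conjLocal L (IsCMField.complexConj L) v))ᵀ = (UnitaryGroup.adelicForm L 3 H').map (UnitaryGroup.adeleToLocal L v))
    (hHd : IsUnit ((UnitaryGroup.adelicForm L 3 H').map (UnitaryGroup.adeleToLocal L v)).det)
    {b ε π a₁ d₁ : UnitaryGroup.LocalRing L v} (hb : b + UnitaryGroup.conjLocal L (IsCMField.complexConj L) v b = 1)
    (hε : UnitaryGroup.conjLocal L (IsCMField.complexConj L) v ε * ε = -1) (hσπ : UnitaryGroup.conjLocal L (IsCMField.complexConj L) v π = π)
    (hπN : ∀ z : UnitaryGroup.LocalRing L v, UnitaryGroup.conjLocal L (IsCMField.complexConj L) v z * z ≠ π)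
    {Tl P Q dπ g₃ g₄ : GL (Fin 3) (UnitaryGroup.LocalRing L v)}
    (hform : formCongr (UnitaryGroup.conjLocal L (IsCMField.complexConj L) v) Tl
        (Matrix.of fun i j : Fin 3 => if i.val + j.val + 1 = 3 then (1 : UnitaryGroup.LocalRing L v) else 0) =
      (UnitaryGroup.adelicForm L 3 H').map (UnitaryGroup.adeleToLocal L v))
    {t₁ t₂ t₃ t₄ : (UnitaryGroup.cmDatum L 3 H').Local v}
    (h₁ : IsLocalNormPair L H' v a t₁) (h₃ : IsLocalNormPair L H' v a t₃) (h₄ : IsLocalNormPair L H' v a t₄)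
    (hP : (t₁.val.val : Matrix (Fin 3) (Fin 3) (UnitaryGroup.LocalRing L v)) * P.val = P.val * diagonal ![a₁, finGammaTwo L v a, d₁])
    (hu' : Function.Injective ![a₁, finGammaTwo L v a, d₁])
    (hu'1 : ∀ i, UnitaryGroup.conjLocal L (IsCMField.complexConj L) v (![a₁, finGammaTwo L v a, d₁] i) * ![a₁, finGammaTwo L v a, d₁] i = 1)
    (hPQ : P = Tl⁻¹ * Q) (hQ : Q.val = !![(1 : UnitaryGroup.LocalRing L v), 0, 1; 0, 1, 0; b, 0, -UnitaryGroup.conjLocal L (IsCMField.complexConj L) v b])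
    (hdπ : dπ.val = !![π, 0, 0; 0, 1, 0; 0, 0, 1])
    (hG₃ : twistGram (UnitaryGroup.conjLocal L (IsCMField.complexConj L) v)
        (Matrix.of fun i j : Fin 3 => if i.val + j.val + 1 = 3 then (1 : UnitaryGroup.LocalRing L v) else 0) (g₃.val * Q.val) = !![π, 0, 0; 0, -π, 0; 0, 0, -1])
    (hG₄ : twistGram (UnitaryGroup.conjLocal L (IsCMField.complexConj L) v)
        (Matrix.of fun i j : Fin 3 => if i.val + j.val + 1 = 3 then (1 : UnitaryGroup.LocalRing L v) else 0) (g₄.val * Q.val) = !![1, 0, 0; 0, π, 0; 0, 0, -π])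
    (ht₂ : Tl * t₂.val * Tl⁻¹ = dπ * (Tl * t₁.val * Tl⁻¹) * dπ⁻¹) (ht₃ : Tl * t₃.val * Tl⁻¹ = g₃ * (Tl * t₁.val * Tl⁻¹) * g₃⁻¹)
    (ht₄ : Tl * t₄.val * Tl⁻¹ = g₄ * (Tl * t₁.val * Tl⁻¹) * g₄⁻¹) :
    finKappaAt L v H' a t₁ = 1 ∧ finKappaAt L v H' a t₂ = 1 ∧ finKappaAt L v H' a t₃ = -1 ∧ finKappaAt L v H' a t₄ = -1 := by
  have hv : Subsingleton (UnitaryGroup.PlacesOver L v) :=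
    UnitaryGroup.PlacesOver.subsingleton_of_smul_eq (IsCMField.complexConj L) (IsCMField.complexConj_ne_one L) w hw
  haveI : Algebra.IsQuadraticExtension ↥(maximalRealSubfield L) L := IsCMField.isQuadraticExtension L
  letI : Field (UnitaryGroup.LocalRing L v) :=
    (UnitaryGroup.LocalRing.isField_of_smul_eq (IsCMField.complexConj L) (IsCMField.complexConj_ne_one L) w hw).toField
  obtain ⟨δ, hcδ, hδ⟩ := exists_complexConj_eq_neg_ne_zero' L
  have hσσ : ∀ x, UnitaryGroup.conjLocal L (IsCMField.complexConj L) v (UnitaryGroup.conjLocal L (IsCMField.complexConj L) v x) = x :=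
    Liu2021.LemD1OfPlace.conjLocal_conjLocal_apply L v (IsCMField.complexConj L) hcδ hδ
  have hj : ![a₁, finGammaTwo L v a, d₁] 1 = finGammaTwo L v a := rfl
  -- lengths against `P = Tl⁻¹ Q_b` and against `Tl⁻¹ (g Q_b)` are `Φ₃`-lengths
  have hPval : P.val = Tl⁻¹.val * Q.val := by rw [hPQ, Units.val_mul]
  have hmid : twistGram (UnitaryGroup.conjLocal L (IsCMField.complexConj L) v)
      (Matrix.of fun i j : Fin 3 => if i.val + j.val + 1 = 3 then (1 : UnitaryGroup.LocalRing L v) else 0) Q.val 1 1 = 1 := by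
    rw [hQ, twistGram_traceFrame (UnitaryGroup.conjLocal L (IsCMField.complexConj L) v) hσσ hb]
    rfl
  -- κ(t₁) = +1: the middle length of the trace frame is the unit `1`, a norm
  have hκ₁ : finKappaAt L v H' a t₁ = 1 := by
    rw [finKappaAt_eq_ite_twistGram_eigenframe L v H' a t₁ hv h₁ hu hP hj, if_pos]
    refine ⟨1, isUnit_one, ?_⟩
    rw [hPval, twistGram_inv_mul_eq_of_formCongr L v H' hform, hmid, map_one, mul_one]
  -- the conjugators `cᵢ = Tl⁻¹ gᵢ Tl` and their middle norm tests
  have conj : ∀ {g : GL (Fin 3) (UnitaryGroup.LocalRing L v)} {t : (UnitaryGroup.cmDatum L 3 H').Local v},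
      Tl * t.val * Tl⁻¹ = g * (Tl * t₁.val * Tl⁻¹) * g⁻¹ → (Tl⁻¹ * g * Tl) * t₁.val * (Tl⁻¹ * g * Tl)⁻¹ = t.val := by
    intro g t h
    have h' : t.val = Tl⁻¹ * (g * (Tl * t₁.val * Tl⁻¹) * g⁻¹) * Tl := by rw [← h]; group
    rw [h']; group
  have test : ∀ (g : GL (Fin 3) (UnitaryGroup.LocalRing L v)) (t : (UnitaryGroup.cmDatum L 3 H').Local v),
      Tl * t.val * Tl⁻¹ = g * (Tl * t₁.val * Tl⁻¹) * g⁻¹ →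
      (finKappaAt L v H' a t = finKappaAt L v H' a t₁ ↔
        ∃ z : UnitaryGroup.LocalRing L v, IsUnit z ∧
          twistGram (UnitaryGroup.conjLocal L (IsCMField.complexConj L) v)
              (Matrix.of fun i j : Fin 3 => if i.val + j.val + 1 = 3 then (1 : UnitaryGroup.LocalRing L v) else 0) (g.val * Q.val) 1 1 =
            UnitaryGroup.conjLocal L (IsCMField.complexConj L) v z * z *
              twistGram (UnitaryGroup.conjLocal L (IsCMField.complexConj L) v)
                (Matrix.of fun i j : Fin 3 => if i.val + j.val + 1 = 3 then (1 : UnitaryGroup.LocalRing L v) else 0) Q.val 1 1) := by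
    intro g t h
    rw [finKappaAt_conj_eq_iff_normTest L v H' a t₁ t w hw h₁ hu hH hHd hP hu' hu'1 hj (conj h), hPval,
      show (Tl⁻¹ * g * Tl).val * (Tl⁻¹.val * Q.val) = Tl⁻¹.val * (g.val * Q.val) by
        rw [Units.val_mul, Units.val_mul]; simp only [Matrix.mul_assoc]; rw [← Matrix.mul_assoc Tl.val, ← Units.val_mul, mul_inv_cancel, Units.val_one, Matrix.one_mul],
      twistGram_inv_mul_eq_of_formCongr L v H' hform, twistGram_inv_mul_eq_of_formCongr L v H' hform]
  have hκ₂ : finKappaAt L v H' a t₂ = 1 := by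
    rw [← hκ₁]
    exact (test dπ t₂ ht₂).2
      ((normTest_diag_conj_traceFrame_iff (UnitaryGroup.conjLocal L (IsCMField.complexConj L) v) hσσ hb hσπ hπN hQ hdπ 1).2 (by decide))
  have hκ₃ : finKappaAt L v H' a t₃ = -1 := by
    rcases finKappaAt_eq_one_or_eq_neg_one_of_isUnit L v H' a t₃ h₃ hu with h | h
    · exfalso
      have ht := (test g₃ t₃ ht₃).1 (h.trans hκ₁.symm)
      exact absurd ((normTest_conj110_iff (UnitaryGroup.conjLocal L (IsCMField.complexConj L) v) hσσ hb hπN hε hQ hG₃ 1).1 ht) (by decide)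
    · exact h
  have hκ₄ : finKappaAt L v H' a t₄ = -1 := by
    rcases finKappaAt_eq_one_or_eq_neg_one_of_isUnit L v H' a t₄ h₄ hu with h | h
    · exfalso
      have ht := (test g₄ t₄ ht₄).1 (h.trans hκ₁.symm)
      exact absurd ((normTest_conj011_iff (UnitaryGroup.conjLocal L (IsCMField.complexConj L) v) hσσ hb hπN hQ hG₄ 1).1 ht) (by decide)
    · exact h
  exact ⟨hκ₁, hκ₂, hκ₃, hκ₄⟩

end Signs

end Literature.NumberTheory.Rogawski1990

end
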